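import Literature.NumberTheory.EllipticCurves.Kato2004.IwasawaCohomologyZetaLiftTwo
import Literature.NumberTheory.EllipticCurves.Kato2004.H1CoefficientChangeProofs
import HarnessLib

/-!
# Kato 2004 §13.1 / Thm. 13.4 at `p = 2`, TRANSPORTED: the odd-branch Λ-adic class `ỹ ∈ 𝐇¹_Γ(T₂W)` of an Euler system for
# ANOTHER lattice `T₂A` (the quadratic twist `A = W^{(−1)}`), carried along a `ℤ₂`-isomorphism `u : T₂A ≃ T₂W` equivariant on the
# levels `Gal(ℚ̄/ℚ(μ_{2^{n+2}}))` — `ỹ_n = Cor_{ℚ(μ_{2^{n+2}})/ℚ_n}(u_* z′_{n+2,∅})` — is PINNED (norm-compatible, integral, unique)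

Topic `NumberTheory/EllipticCurves`, sub-directory `Kato2004` (namespace = path). Cell `bsd-2adic` (run/shared/lean/pub/bsd-2adic/),
seat `bsd-2adic-addL2x` GEN 21 (crux stmt-BirchSwinnertonDyer-19098 `AdditiveRankZeroAtTwo`, child C4″ stmt-BirchSwinnertonDyer-22618;
reading step T22 (b) of the descent sockets, ODD-BRANCH side; repair-census entry R-B84 (1)). The `p = 2` zeta lift
`IwasawaH1Data.existsUnique_lift_of_zetaBody_two` (seat `bsd-2adic-conv-2`) pins the Λ-adic class of `W`'s OWN Euler system; the
descent sockets' transported class `z̃` («`Z = Λ·cor(z_γ^{(2)}(f′))`, Thm. 12.6's zeta module of `f′`, transported», docstring of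
`Kato2004.SplitTwistDivisibilityInputsDescent.Z`) is the class of the Euler system of the TWIST `A = W^{(−1)}` for `T₂A`, moved to
`T₂W` along the twist identification `u : T₂A ≃ T₂W` (Silverman X.5 Cor. 5.4; `u` is `Gal(ℚ̄/ℚ(i))`-equivariant, so equivariant on
every level `Gal(ℚ̄/ℚ(μ_{2^{n+2}}))`, `n ≥ 0`) and corestricted to the layers `ℚ_n` of the cyclotomic `ℤ₂`-tower (`res ∘ cor = 1 + c_W =
1 − c_A`: the ODD branch of `Δ = Gal(ℚ(μ_{2^∞})/ℚ_∞)`, Kato 12.1; Rubin, *Euler Systems*, Ch. VI «twisting by characters of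
`Gal(K_∞/K)`»). THIS FILE pins that class: for an Euler system `z′` for `T₂A` on the levels of `cyclotomicLevelsRat 2 S` (no
condition at `k ≤ 1`), the family `ỹ_n := Cor_{ℚ(μ_{2^{n+2}})/ℚ_n}(u_* z′_{n+2,∅})` (`levelToLayerTwo ∘ twistH1On`) is norm-compatible
(`u_*` commutes with corestriction, `twistH1On_coresLe`; transitivity `levelToLayerTwo_layerCores_comm`; the `2`-direction relation
`IsEulerSystem.cores_p`) and integral (`twistH1On_mem_integralH1`, `coresLe_mem_integralH1`), hence defines a UNIQUE element of any pin
`I : IwasawaH1Data W 2 κ γ`.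

* `twistLevelToLayerTwo_layerCores_comm` — norm compatibility of the transported family;
* `IwasawaH1Data.existsUnique_twistLift_of_isEulerSystem_two` — the lift from an Euler system `z′` for `T₂A` with integral
  `2`-power classes;
* `IwasawaH1Data.existsUnique_twistLift_of_zetaBody_two` — the lift from a `ZetaBody A 2 f′ …` witness ((C1)+(C2)).
THEOREMS ONLY (no definition, no named fact); nothing asserted beyond the displayed hypotheses; BSD is not advanced.

References: K. Kato, Astérisque 295 (2004) §12.1–12.2 (pp. 219–220), §13.1 and Thm. 13.4 (pp. 224–226), §8.2 (pp. 180–181)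
[Kato2004Asterisque]; K. Rubin, *Euler Systems* (2000) Ch. II §4, Ch. VI [Rubin2000]; J. H. Silverman, *AEC* (2009) X.5 Cor. 5.4
[SilvermanAEC2009]; L. C. Washington, *Introduction to Cyclotomic Fields* §13.1 [Washington1997]; tree `Kato2004/IwasawaCohomologyZetaLiftTwo.lean`,
`Kato2004/H1CoefficientChange{,Proofs}.lean`.
-/

noncomputable section

open scoped NumberField TensorProduct
open Field IsDedekindDomain
open Literature.NumberTheory.GaloisRepresentations
open Literature.NumberTheory.EllipticCurves Literature.NumberTheory.EllipticCurves.Kato2004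
open Literature.NumberTheory.EllipticCurves.Kato2004.EulerSystemValues Rat.HeightOneSpectrum

namespace Literature.NumberTheory.EllipticCurves.Kato2004

variable (W : WeierstrassCurve ℚ) [W.IsElliptic] [ContinuousSMul ℤ_[2] (W.tateModule 2)]
  (A' : WeierstrassCurve ℚ) [A'.IsElliptic] [ContinuousSMul ℤ_[2] (A'.tateModule 2)]
  [Module.Free ℤ_[2] (A'.tateModule 2)] [Module.Finite ℤ_[2] (A'.tateModule 2)]
  (u : A'.tateModule 2 ≃ₗ[ℤ_[2]] W.tateModule 2) (hu : Continuous u)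

omit [W.IsElliptic] [ContinuousSMul ℤ_[2] (W.tateModule 2)] [A'.IsElliptic] [ContinuousSMul ℤ_[2] (A'.tateModule 2)]
  [Module.Free ℤ_[2] (A'.tateModule 2)] [Module.Finite ℤ_[2] (A'.tateModule 2)] in
/-- **From the level groups `cycSubgroup 2 k r` (`k ≥ 2`) to the levels of `cyclotomicLevelsRat 2 S`**: the two are the same
subgroup `Gal(ℚ̄/ℚ(μ_{2^k·∏ℓ}))` (`cycSubgroup_eq_level`, definitional), so an identification `u` equivariant on the former — the
shape displayed by the pair construction fact `exists_eulerSystem_expStar_values_negOneTwistPair_two` — is equivariant on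
`Gal(ℚ̄/ℚ(μ_{2^{n+2}}))` written as the level `(n + 2, ∅)` of any `cyclotomicLevelsRat 2 S` (the shape used below).
[cite: Rubin2000, Remark 2.1.4] -/
theorem equivariant_level_of_cycSubgroup
    (hV : ∀ k : ℕ, 2 ≤ k → ∀ (r : Finset (HeightOneSpectrum (𝓞 ℚ))) (σ : absoluteGaloisGroup ℚ),
      σ ∈ cycSubgroup 2 k r → ∀ x : A'.tateModule 2, u (σ • x) = σ • u x)
    (S : Set (HeightOneSpectrum (𝓞 ℚ))) (n : ℕ) :
    ∀ σ : absoluteGaloisGroup ℚ, σ ∈ (cyclotomicLevelsRat 2 S).level (n + 2) ∅ →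
      ∀ x : A'.tateModule 2, u (σ • x) = σ • u x :=
  fun σ hσ x ↦ hV (n + 2) (Nat.le_add_left 2 n) ∅ σ (by rw [cycSubgroup_eq_level 2 S (n + 2) ∅]; exact hσ) x

variable {S : Set (HeightOneSpectrum (𝓞 ℚ))}
  (hVS : ∀ (n : ℕ) (σ : absoluteGaloisGroup ℚ), σ ∈ (cyclotomicLevelsRat 2 S).level (n + 2) ∅ →
    ∀ x : A'.tateModule 2, u (σ • x) = σ • u x)
  {κ : ZpExtension ℚ 2} (hκ : κ.IsCyclotomic)

/-- **Norm compatibility of the transported family**: for an Euler system `z′` for `T₂A` on `cyclotomicLevelsRat 2 S`,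
`Cor_{ℚ_{n+1}/ℚ_n}(Cor_{ℚ(μ_{2^{n+3}})/ℚ_{n+1}}(u_* z′_{n+3,∅})) = Cor_{ℚ(μ_{2^{n+2}})/ℚ_n}(u_* z′_{n+2,∅})` — transitivity of corestriction
(`levelToLayerTwo_layerCores_comm`), `u_*` commutes with `Cor_{ℚ(μ_{2^{n+3}})/ℚ(μ_{2^{n+2}})}` (`twistH1On_coresLe`), and the
`2`-direction Euler-system relation (`IsEulerSystem.cores_p`, no Euler factor). [cite: Kato2004Asterisque, §13.1 (13.1.1) and Thm. 13.4 (pp. 224–226)]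
[cite: Rubin2000, Def. 2.1.1 and Ch. VI] -/
theorem twistLevelToLayerTwo_layerCores_comm
    (z' : ∀ (k : ℕ) (r : (cyclotomicLevelsRat 2 S).Ideals), H1 (tateRep A' 2) ((cyclotomicLevelsRat 2 S).level k r.1))
    (hz' : IsEulerSystem (cyclotomicLevelsRat 2 S) (tateRep A' 2) 2 z') (n : ℕ) :
    layerCores (tateRep W 2) κ n
        (levelToLayerTwo W hκ S (n + 1)
          (twistH1On W A' u hu (hVS (n + 1)) (z' (n + 3) (cyclotomicLevelsRat 2 S).idealOne))) =
      levelToLayerTwo W hκ S n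
        (twistH1On W A' u hu (hVS n) (z' (n + 2) (cyclotomicLevelsRat 2 S).idealOne)) := by
  rw [levelToLayerTwo_layerCores_comm W hκ S n]
  congr 1
  -- `coresP ∘ u_* = u_* ∘ coresP` on the `2`-power levels, then the Euler-system relation
  rw [← hz'.cores_p (Nat.le_succ (n + 2)) (cyclotomicLevelsRat 2 S).idealOne]
  unfold EulerSystemLevels.coresP
  letI : Fintype ((cyclotomicLevelsRat 2 S).level (n + 2) ∅ ⧸
      ((cyclotomicLevelsRat 2 S).level (n + 3) ∅).subgroupOf ((cyclotomicLevelsRat 2 S).level (n + 2) ∅)) :=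
    Fintype.ofFinite _
  exact (twistH1On_coresLe W A' u hu (hVS n)
    ((cyclotomicLevelsRat 2 S).level_mono_left (Nat.le_succ (n + 2)) ∅) ((cyclotomicLevelsRat 2 S).isOpen_level (n + 3) ∅)
    (z' (n + 3) (cyclotomicLevelsRat 2 S).idealOne)).symm

variable {γ : absoluteGaloisGroup ℚ} (I : IwasawaH1Data W 2 κ γ)

/-- **The TRANSPORTED Λ-adic class is pinned (Kato §13.1 / Thm. 13.4 at `p = 2`, along `u : T₂A ≃ T₂W`).** For an Euler system `z′`
for `T₂A` on the levels of `cyclotomicLevelsRat 2 S`, GRANTED that the classes `u_* z′_{n+2,∅}` are integral after corestriction to the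
layers (`hint`), there is a UNIQUE `ỹ ∈ 𝐇¹_Γ(T₂W)` (the pinned `IwasawaH1Data` of `W`) with
`proj_n ỹ = Cor_{ℚ(μ_{2^{n+2}})/ℚ_n}(u_* z′_{n+2,∅})` for all `n`; norm compatibility is `twistLevelToLayerTwo_layerCores_comm`.
[cite: Kato2004Asterisque, §13.1 and Thm. 13.4 (pp. 224–226), §12.2 (p. 220)] [cite: Rubin2000, Ch. VI] -/
theorem IwasawaH1Data.existsUnique_twistLift_of_isEulerSystem_two
    (z' : ∀ (k : ℕ) (r : (cyclotomicLevelsRat 2 S).Ideals), H1 (tateRep A' 2) ((cyclotomicLevelsRat 2 S).level k r.1))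
    (hz' : IsEulerSystem (cyclotomicLevelsRat 2 S) (tateRep A' 2) 2 z')
    (hint : ∀ n : ℕ, levelToLayerTwo W hκ S n
      (twistH1On W A' u hu (hVS n) (z' (n + 2) (cyclotomicLevelsRat 2 S).idealOne)) ∈
        integralH1 (tateRep W 2) 2 (κ.layerSubgroup n)) :
    ∃! y : I.H, ∀ n : ℕ, I.proj n y = levelToLayerTwo W hκ S n
      (twistH1On W A' u hu (hVS n) (z' (n + 2) (cyclotomicLevelsRat 2 S).idealOne)) :=
  I.exists_unique_lift ⟨hint, fun n ↦ twistLevelToLayerTwo_layerCores_comm W A' u hu hVS hκ z' hz' n⟩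

/-- **The transported zeta class at `p = 2` from a `ZetaBody` witness of the OTHER curve.** Let `(κ', Λ', z′, x′)` satisfy
`ZetaBody A 2 f′ ι κ' Λ' c d a N′ z′ x′` (Kato's Euler system for `T₂A` with its values — e.g. `A = W^{(−1)}`, `f′` its newform) and
let `u : T₂A ≃ T₂W` be continuous and equivariant on the levels `Gal(ℚ̄/ℚ(μ_{2^k·∏ℓ}))`, `k ≥ 2`. Then for any cyclotomic `ℤ₂`-tower
datum `I : IwasawaH1Data W 2 κ γ` there is a UNIQUE `ỹ ∈ 𝐇¹_Γ(T₂W)` whose `n`-th layer component is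
`Cor_{ℚ(μ_{2^{n+2}})/ℚ_n}(u_* z′_{n+2,∅})` for every `n`: (C1) gives the norm compatibility, (C2) with `twistH1On_mem_integralH1` and
`coresLe_mem_integralH1` (the level is normal and unramified away from `2`) the integrality. This is the class the descent sockets
of crux 19098 call `z̃` (the odd-branch transport of `z(f′)`). No hypothesis beyond the witness and `u`; nothing asserted.
[cite: Kato2004Asterisque, §13.1 and Thm. 13.4 (pp. 224–226), §12.1–12.2 (pp. 219–220), §8.2 (pp. 180–181)] [cite: Rubin2000, Ch. VI]
[cite: Washington1997, §13.1] -/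
theorem IwasawaH1Data.existsUnique_twistLift_of_zetaBody_two
    (hV : ∀ k : ℕ, 2 ≤ k → ∀ (r : Finset (HeightOneSpectrum (𝓞 ℚ))) (σ : absoluteGaloisGroup ℚ),
      σ ∈ cycSubgroup 2 k r → ∀ x : A'.tateModule 2, u (σ • x) = σ • u x)
    {N' : ℕ} (f' : CuspForm (CongruenceSubgroup.Gamma0 N') 2)
    (ι : (m : ℕ) → (CyclotomicField m ℚ →+* ℂ)) (κ' : ℝ)
    (Λ' : ∀ (k : ℕ) (r : Finset (HeightOneSpectrum (𝓞 ℚ))),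
      H1 (tateRep A' 2) (cycSubgroup 2 k r) →ₗ[ℤ_[2]] ℚ_[2] ⊗[ℚ] CyclotomicField (cycLevel 2 k r) ℚ)
    (c d a : ℤ) (A : ℕ)
    (z' : ∀ (k : ℕ) (r : (cyclotomicLevelsRat 2 (badPlaces c d A N')).Ideals),
      H1 (tateRep A' 2) ((cyclotomicLevelsRat 2 (badPlaces c d A N')).level k r.1))
    (x' : ∀ (k : ℕ) (r : (cyclotomicLevelsRat 2 (badPlaces c d A N')).Ideals), CyclotomicField (cycLevel 2 k r.1) ℚ)
    (hbody : ZetaBody A' 2 f' ι κ' Λ' c d a A z' x') :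
    ∃! y : I.H, ∀ n : ℕ, I.proj n y = levelToLayerTwo W hκ (badPlaces c d A N') n
      (twistH1On W A' u hu (equivariant_level_of_cycSubgroup W A' u hV (badPlaces c d A N') n)
        (z' (n + 2) (cyclotomicLevelsRat 2 (badPlaces c d A N')).idealOne)) := by
  refine IwasawaH1Data.existsUnique_twistLift_of_isEulerSystem_two W A' u hu
    (equivariant_level_of_cycSubgroup W A' u hV (badPlaces c d A N')) hκ I z' hbody.1 fun n ↦ ?_
  -- integrality: (C2) for `z′`, `u_*` preserves integrality, `Cor` preserves integrality
  haveI : ((cyclotomicLevelsRat 2 (badPlaces c d A N')).level (n + 2) ∅).Normal :=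
    normal_cyclotomicLevelsRat_level_empty 2 (badPlaces c d A N') (n + 2)
  haveI : ((cyclotomicLevelsRat 2 (badPlaces c d A N')).level (n + 2) ∅).FiniteIndex :=
    finiteIndex_of_isOpen_of_compactSpace _ ((cyclotomicLevelsRat 2 (badPlaces c d A N')).isOpen_level (n + 2) ∅)
  haveI : Fintype (κ.layerSubgroup n ⧸
      ((cyclotomicLevelsRat 2 (badPlaces c d A N')).level (n + 2) ∅).subgroupOf (κ.layerSubgroup n)) := Fintype.ofFinite _
  have hz : z' (n + 2) (cyclotomicLevelsRat 2 (badPlaces c d A N')).idealOne ∈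
      integralH1 (tateRep A' 2) 2 ((cyclotomicLevelsRat 2 (badPlaces c d A N')).level (n + 2) ∅) :=
    fun v hv 𝔓 h𝔓 ↦ hbody.2.1 (n + 2) (cyclotomicLevelsRat 2 (badPlaces c d A N')).idealOne v hv 𝔓 h𝔓
  have huz := twistH1On_mem_integralH1 W A' u hu (equivariant_level_of_cycSubgroup W A' u hV (badPlaces c d A N') n) hz
  have key := coresLe_mem_integralH1 (tateRep W 2) 2
    (hκ.cyclotomicLevelsRat_level_le_layerSubgroup_two (badPlaces c d A N') n)
    ((cyclotomicLevelsRat 2 (badPlaces c d A N')).isOpen_level (n + 2) ∅)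
    (fun v hv ↦ cyclotomicLevelsRat_level_empty_unramifiedAt 2 (badPlaces c d A N') (n + 2) v hv) huz
  unfold levelToLayerTwo
  convert key using 4

end Literature.NumberTheory.EllipticCurves.Kato2004

end
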